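import Summits.QuantumFields.YangMills.Theorems.ColdStartUniversalityLatticeLangevinLatitudeAlgebra
import HarnessLib

/-!
# Route `ColdStartUniversality`, crux K_A1 `UniformColdStartMixing` (stmt-QuantumFields-24809), rung `stub_fixedCutoffMixing`:
# the Casimir matrix of `𝔰𝔲(2)` in the fundamental representation is `-(3/2) 1`

Helper file (seat `ym-line-csu-p1`, g7), companion of `…LatticeLangevinLatitudeAlgebra`.  The drift of the `β' = 0` SZZ
dynamics is `C Q_e dt` with `C = Σₙ 𝐩(Eₙ)²` (`LatticeRep.casimir`); for `SU(2)` in its fundamental representation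
`C = Σₐ vₐ²` over the orthonormal basis `vₐ = i σₐ / √2` of `(𝔰𝔲(2), Re tr(X Yᴴ))` (Parseval), `= -(3/2) 1`
(`casimir_two`), so that `⟨X, C Y⟩ = -(3/2) ⟨X, Y⟩` (`hsForm_casimir_two_mul`): on a ridge function the drift acts as
`-(3/2) s F'(s)`, the first-order part of the Jacobi operator `½[(1 - s²) F'' - 3 s F']`.

Contents: the integer basis `i σ₁, i σ₂, i σ₃` (skew-Hermitian, traceless, `⟨i σₐ, i σ_b⟩ = 2 δ`, `Σ (i σₐ)² = -3·1`), the
expansion of a traceless skew-Hermitian matrix in it, and the Parseval computation of the Casimir.  No definition, no sorry.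
RECORD-rung R3 plumbing; nothing here bears on the mass gap.
-/

set_option autoImplicit false

noncomputable section

namespace Summit.QuantumFields.YangMills.Theorems.ColdStartUniversality

open Matrix Complex Finset
open scoped ComplexConjugate BigOperators
open Literature.MathematicalPhysics.QuantumFieldTheory
open Literature.MathematicalPhysics.QuantumLattice (fundamentalRep fundamentalLatticeRep)

/-! ### The basis `i σₐ` of `𝔰𝔲(2)` -/

/-- `i σₐ` is skew-Hermitian. [folklore] -/
theorem star_su2Dir (a : Fin 3) : star ((![!![0, Complex.I; Complex.I, 0], !![0, 1; -1, 0], !![Complex.I, 0; 0,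
      -Complex.I]] : Fin 3 → Matrix (Fin 2) (Fin 2) ℂ) a) = -(![!![0, Complex.I; Complex.I, 0], !![0, 1; -1, 0],
      !![Complex.I, 0; 0, -Complex.I]] : Fin 3 → Matrix (Fin 2) (Fin 2) ℂ) a := by
  fin_cases a <;>
  · ext i j
    fin_cases i <;> fin_cases j <;> simp [Matrix.star_apply]

/-- `i σₐ` is traceless. [folklore] -/
theorem trace_su2Dir (a : Fin 3) : ((![!![0, Complex.I; Complex.I, 0], !![0, 1; -1, 0], !![Complex.I, 0; 0,
      -Complex.I]] : Fin 3 → Matrix (Fin 2) (Fin 2) ℂ) a).trace = 0 := by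
  fin_cases a <;> simp [Matrix.trace_fin_two]

/-- `Re tr((i σₐ)(i σ_b)ᴴ) = 2 δ_{ab}`. [folklore] -/
theorem hsForm_su2Dir (a b : Fin 3) : hsForm 2 ((![!![0, Complex.I; Complex.I, 0], !![0, 1; -1, 0], !![Complex.I, 0; 0,
      -Complex.I]] : Fin 3 → Matrix (Fin 2) (Fin 2) ℂ) a) ((![!![0, Complex.I; Complex.I, 0], !![0, 1; -1, 0],
      !![Complex.I, 0; 0, -Complex.I]] : Fin 3 → Matrix (Fin 2) (Fin 2) ℂ) b) = if a = b then 2 else 0 := by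
  rw [hsForm_eq_sum_entries]
  fin_cases a <;> fin_cases b <;> simp [Fin.sum_univ_two] <;> norm_num

/-- `Σₐ (i σₐ)² = -3 • 1`. [folklore] -/
theorem sum_su2Dir_mul_self : ∑ a : Fin 3, (![!![0, Complex.I; Complex.I, 0], !![0, 1; -1, 0], !![Complex.I, 0; 0,
      -Complex.I]] : Fin 3 → Matrix (Fin 2) (Fin 2) ℂ) a * (![!![0, Complex.I; Complex.I, 0], !![0, 1; -1, 0],
      !![Complex.I, 0; 0, -Complex.I]] : Fin 3 → Matrix (Fin 2) (Fin 2) ℂ) a = -(3 : ℂ) • (1 : Matrix (Fin 2) (Fin 2) ℂ) := by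
  rw [Fin.sum_univ_three]
  ext i j
  fin_cases i <;> fin_cases j <;> simp <;> norm_num

/-- **Expansion in the basis `i σₐ`**: a traceless skew-Hermitian `2 × 2` matrix `X` satisfies
`X = ½ Σₐ ⟨X, i σₐ⟩ (i σₐ)`. [folklore] -/
theorem eq_sum_hsForm_su2Dir_smul {X : Matrix (Fin 2) (Fin 2) ℂ} (hX : star X = -X) (htr : X.trace = 0) :
    X = ∑ a : Fin 3, (((hsForm 2 X ((![!![0, Complex.I; Complex.I, 0], !![0, 1; -1, 0], !![Complex.I, 0; 0,
          -Complex.I]] : Fin 3 → Matrix (Fin 2) (Fin 2) ℂ) a) / 2 : ℝ)) : ℂ) • (![!![0, Complex.I; Complex.I, 0], !![0,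
          1; -1, 0], !![Complex.I, 0; 0, -Complex.I]] : Fin 3 → Matrix (Fin 2) (Fin 2) ℂ) a := by
  -- entries of `X`: `X 0 0 = i p`, `X 1 1 = -i p`, `X 1 0 = -conj (X 0 1)`
  have h00 : (X 0 0).re = 0 := by
    have h := congrFun (congrFun hX 0) 0
    rw [Matrix.star_apply, Matrix.neg_apply, Complex.star_def] at h
    have h2 := congrArg Complex.re h
    rw [Complex.conj_re, Complex.neg_re] at h2
    linarith
  have h10 : X 1 0 = -conj (X 0 1) := by
    have h := congrFun (congrFun hX 0) 1
    rw [Matrix.star_apply, Matrix.neg_apply, Complex.star_def] at h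
    have h2 := congrArg (starRingEnd ℂ) h
    rw [Complex.conj_conj, map_neg] at h2
    exact h2
  have h11 : X 1 1 = -X 0 0 := by
    rw [Matrix.trace_fin_two] at htr
    linear_combination htr
  have hc : ∀ a : Fin 3, hsForm 2 X ((![!![0, Complex.I; Complex.I, 0], !![0, 1; -1, 0], !![Complex.I, 0; 0,
        -Complex.I]] : Fin 3 → Matrix (Fin 2) (Fin 2) ℂ) a) = ∑ i, ∑ j, (X i j * conj (((![!![0, Complex.I; Complex.I,
        0], !![0, 1; -1, 0], !![Complex.I, 0; 0, -Complex.I]] : Fin 3 → Matrix (Fin 2) (Fin 2) ℂ) a) i j)).re := fun a =>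
    hsForm_eq_sum_entries X _
  ext i j
  fin_cases i <;> fin_cases j <;>
    simp only [Fin.sum_univ_three, hc, Fin.sum_univ_two, Matrix.add_apply, Matrix.smul_apply, smul_eq_mul] <;>
    simp [h10, h11] <;>
    apply Complex.ext <;> simp [h00]

/-! ### The Casimir -/

/-- **The Casimir matrix of `𝔰𝔲(2)` in the fundamental representation is `-(3/2) 1`** (`Σₙ 𝐩(Eₙ)² = Σₐ vₐ²` over the
orthonormal basis `vₐ = i σₐ / √2`, by Parseval). [cite: ShenZhuZhu2022, §2 "Brownian motions" (c_{su(N)} = -(N²-1)/N)] -/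
theorem casimir_two : (fundamentalLatticeRep 2).casimir = ((-(3 / 2 : ℝ) : ℝ) : ℂ) • (1 : Matrix (Fin
      (fundamentalLatticeRep 2).N) (Fin (fundamentalLatticeRep 2).N) ℂ) := by
  -- the basis, in the carrier type
  set v : Fin 3 → Matrix (Fin (fundamentalLatticeRep 2).N) (Fin (fundamentalLatticeRep 2).N) ℂ := fun a => (![!![0,
        Complex.I; Complex.I, 0], !![0, 1; -1, 0], !![Complex.I, 0; 0, -Complex.I]] : Fin 3 → Matrix (Fin 2) (Fin 2) ℂ)
        a with hv
  have hvskew : ∀ a, star (v a) = -v a := fun a => star_su2Dir a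
  have hvtr : ∀ a, (v a).trace = 0 := fun a => trace_su2Dir a
  have hvmem : ∀ a, v a ∈ (fundamentalLatticeRep 2).lieAlg := fun a => mem_lieAlg_two_of_star_eq_neg (hvskew a) (hvtr a)
  have hvv : ∀ a b, hsForm (fundamentalLatticeRep 2).N (v a) (v b) = if a = b then 2 else 0 := fun a b => hsForm_su2Dir a b
  -- expansion of `𝐩 Eₙ`
  have hexp : ∀ n : NoiseIdx (fundamentalLatticeRep 2).N, (fundamentalLatticeRep 2).lieProj (noiseDir n) =
      ∑ a : Fin 3, (((hsForm (fundamentalLatticeRep 2).N (noiseDir n) (v a) / 2 : ℝ)) : ℂ) • v a := by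
    intro n
    have h := eq_sum_hsForm_su2Dir_smul ((fundamentalLatticeRep 2).star_lieProj (noiseDir n))
      (trace_eq_zero_of_mem_lieAlg_two ((fundamentalLatticeRep 2).lieProj_mem (noiseDir n)))
    have hcoef : ∀ a, hsForm (fundamentalLatticeRep 2).N ((fundamentalLatticeRep 2).lieProj (noiseDir n)) (v a) =
          hsForm (fundamentalLatticeRep 2).N (noiseDir n) (v a) := by
      intro a
      rw [hsForm_lieProj_comm, (fundamentalLatticeRep 2).lieProj_of_mem (hvmem a)]
    refine h.trans (Finset.sum_congr rfl fun a _ => ?_)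
    rw [← hcoef a]
    rfl
  -- Parseval
  unfold LatticeRep.casimir
  simp_rw [hexp]
  have hstep : ∀ n : NoiseIdx (fundamentalLatticeRep 2).N,
      (∑ a : Fin 3, (((hsForm (fundamentalLatticeRep 2).N (noiseDir n) (v a) / 2 : ℝ)) : ℂ) • v a) *
        (∑ b : Fin 3, (((hsForm (fundamentalLatticeRep 2).N (noiseDir n) (v b) / 2 : ℝ)) : ℂ) • v b) =
      ∑ a : Fin 3, ∑ b : Fin 3, (((hsForm (fundamentalLatticeRep 2).N (noiseDir n) (v a) / 2 * (hsForm
            (fundamentalLatticeRep 2).N (noiseDir n) (v b) / 2)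
        : ℝ)) : ℂ) • (v a * v b) := by
    intro n
    rw [Finset.sum_mul_sum]
    refine Finset.sum_congr rfl fun a _ => Finset.sum_congr rfl fun b _ => ?_
    rw [Matrix.smul_mul, Matrix.mul_smul, smul_smul]
    push_cast
    ring_nf
  simp_rw [hstep]
  rw [Finset.sum_comm]
  have hinner : ∀ a : Fin 3, ∑ n : NoiseIdx (fundamentalLatticeRep 2).N, ∑ b : Fin 3,
      (((hsForm (fundamentalLatticeRep 2).N (noiseDir n) (v a) / 2 * (hsForm (fundamentalLatticeRep 2).N (noiseDir n)
            (v b) / 2) : ℝ)) : ℂ) • (v a * v b) =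
      ((1 / 2 : ℝ) : ℂ) • (v a * v a) := by
    intro a
    rw [Finset.sum_comm]
    have hb : ∀ b : Fin 3, ∑ n : NoiseIdx (fundamentalLatticeRep 2).N,
        (((hsForm (fundamentalLatticeRep 2).N (noiseDir n) (v a) / 2 * (hsForm (fundamentalLatticeRep 2).N (noiseDir n)
              (v b) / 2) : ℝ)) : ℂ) • (v a * v b) =
        (((hsForm (fundamentalLatticeRep 2).N (v a) (v b) / 4 : ℝ)) : ℂ) • (v a * v b) := by
      intro b
      rw [← Finset.sum_smul, ← sum_hsForm_noiseDir_mul (v a) (v b)]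
      congr 1
      push_cast
      rw [Finset.sum_div]
      refine Finset.sum_congr rfl fun n _ => ?_
      rw [hsForm_comm (noiseDir n) (v a), hsForm_comm (noiseDir n) (v b)]
      ring
    simp_rw [hb, hvv]
    rw [Finset.sum_eq_single a]
    · simp only [if_true]; norm_num
    · intro b _ hba
      rw [if_neg (Ne.symm hba), zero_div, Complex.ofReal_zero, zero_smul]
    · intro h; exact absurd (Finset.mem_univ a) h
  simp_rw [hinner]
  rw [← Finset.smul_sum]
  have hsum : ∑ a : Fin 3, v a * v a = -(3 : ℂ) • (1 : Matrix (Fin (fundamentalLatticeRep 2).N) (Fin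
        (fundamentalLatticeRep 2).N) ℂ) := sum_su2Dir_mul_self
  rw [hsum, smul_smul]
  congr 1
  push_cast
  ring

/-- **`⟨X, C Y⟩ = -(3/2) ⟨X, Y⟩`** for the Casimir `C` of `𝔰𝔲(2)` (the drift correction of the `β' = 0` dynamics acts as
the scalar `-3/2`). [folklore] -/
theorem hsForm_casimir_two_mul (X Y : Matrix (Fin (fundamentalLatticeRep 2).N) (Fin (fundamentalLatticeRep 2).N) ℂ) :
    hsForm (fundamentalLatticeRep 2).N X ((fundamentalLatticeRep 2).casimir * Y) = -(3 / 2) * hsForm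
          (fundamentalLatticeRep 2).N X Y := by
  rw [casimir_two, Matrix.smul_mul, Matrix.one_mul, hsForm_coe_smul_right]

end Summit.QuantumFields.YangMills.Theorems.ColdStartUniversality

end
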